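import Mathlib
import Literature.NumberTheory.Transcendental.KZCalculus
import Literature.NumberTheory.Transcendental.SemialgebraicMapsProofs

/-!
# `LegendreCubicForm`, line `Sketch` (hat-box chart): KZ packaging of the hat-box substitution

Crux stmt-KontsevichZagierPeriods-3521 (route UnfoldedStokes), stub `stub_hatBoxTransfer` of the
lead skeleton `work/LegendreCubicForm.lean`.

For rational `e₁ < e₂ < e₃` let `R = (e₁,e₂) × (e₂,e₃) ⊆ ℝ²` be the open period rectangle,
`H = (0,∞) × (0,1)` the open half-strip, `Λ : R → H` the hat-box map
`Λ(λ,μ) = (√((e₃−e₁)(e₂−λ)(μ−e₂)/((e₃−e₂)(λ−e₁)(μ−e₁))), √((e₃−λ)(e₃−μ)/((e₃−e₁)(e₃−e₂))))`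
and `g(λ,μ) = (μ−λ)/√(|P(λ)||P(μ)|)`, `P(x) = (x−e₁)(x−e₂)(x−e₃)`. GIVEN the three analytic facts
(injectivity of `Λ` on `R`, `Λ '' R = H`, and differentiability of `Λ` on `R` with the pull-back
identity `g = (4/(1+u²))∘Λ · |det DΛ|`), every representation `r` pinned by `r.domain = R`,
`r.integrand = g` on `R` is ONE instance of Kontsevich–Zagier's rule (2) away from a representation
`p = [H, 4/(1+u²)]`, which exists: `H` and `4/(1+u²)` are `ℚ`-semialgebraic, and integrability of
`4/(1+u²)` on `H = Λ '' R` is transported along `Λ` from `r.integrableOn` by Mathlib's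
`MeasureTheory.integrableOn_image_iff_integrableOn_abs_det_fderiv_smul`; `Λ` is a
`ℚ`-semialgebraic map (coordinates: square roots of quotients of `ℚ`-polynomials,
`IsSemialgebraicFunOn.sqrt_holds`, `isSemialgebraicFunOn_aeval_div_aeval`,
`IsSemialgebraicMapOn.of_forall`).

References: M. Kontsevich, D. Zagier, *Periods* (2001), §1.2 rule (2); J. Bochnak, M. Coste,
M.-F. Roy, *Real Algebraic Geometry* (1998), §2.2.
-/

noncomputable section

namespace Summit.KontsevichZagierPeriods.UnfoldedStokes.LegendreCubicFormLine

open Set MeasureTheory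
open Literature.NumberTheory.Transcendental
open Literature.ModelTheory.ExponentialFields (IsSemialgebraic isSemialgebraic_setOf_eval_pos)
open MvPolynomial (aeval X C)

/-- **KZ packaging of a planar change of variables (rule (2)).** If `Λ` is a `ℚ`-semialgebraic map
on `R = r.domain`, injective there with image the `ℚ`-semialgebraic set `H`, differentiable at every
point of `R` with the pull-back identity `g x = f (Λ x) · |det DΛ(x)|` for the integrand `g` of `r`
and a `ℚ`-semialgebraic `f` on `H`, then the representation `p = [H, f]` exists (integrability of
`f` on `H = Λ '' R` transported along `Λ`,
`MeasureTheory.integrableOn_image_iff_integrableOn_abs_det_fderiv_smul`) and `[r] − [p]` is a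
change-of-variables generator of the Kontsevich–Zagier calculus.
[cite: KontsevichZagier2001, §1.2 rule (2)] -/
theorem hatBox_changeOfVariables_of (r : KZ.IntegralRep 2) {R H : Set (Fin 2 → ℝ)}
    {Λ : (Fin 2 → ℝ) → (Fin 2 → ℝ)} {g f : (Fin 2 → ℝ) → ℝ} (hrd : r.domain = R)
    (hri : EqOn r.integrand g r.domain) (hinj : InjOn Λ R) (himg : Λ '' R = H)
    (hH : IsSemialgebraic ℚ H) (hf : IsSemialgebraicFunOn ℚ H f) (hΛ : IsSemialgebraicMapOn ℚ R Λ)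
    (hJ : ∀ x ∈ R, ∃ L : (Fin 2 → ℝ) →L[ℝ] (Fin 2 → ℝ),
      HasFDerivAt Λ L x ∧ g x = f (Λ x) * |L.det|) :
    ∃ p : KZ.IntegralRep 2, p.domain = H ∧ p.integrand = f ∧
      KZ.of r - KZ.of p ∈ KZ.changeOfVariablesRel := by
  subst hrd
  choose! Φ' hΦ' using hJ
  have hderiv : ∀ x ∈ r.domain, HasFDerivWithinAt Λ (Φ' x) r.domain x := fun x hx =>
    (hΦ' x hx).1.hasFDerivWithinAt
  have hmeas : MeasurableSet r.domain := KZ.IntegralRep.measurableSet_domain_holds r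
  have hint : IntegrableOn f (Λ '' r.domain) := by
    rw [integrableOn_image_iff_integrableOn_abs_det_fderiv_smul volume hmeas hderiv hinj]
    refine r.integrableOn.congr_fun (fun x hx => ?_) hmeas
    show r.integrand x = |(Φ' x).det| • f (Λ x)
    rw [hri hx, (hΦ' x hx).2, smul_eq_mul, mul_comm]
  rw [himg] at hint
  exact ⟨⟨H, f, hH, hf, hint⟩, rfl, rfl, 2, r, ⟨H, f, hH, hf, hint⟩, Λ, Φ', hΛ, hderiv, hinj,
    himg.symm, fun x hx => by rw [hri hx]; exact (hΦ' x hx).2, rfl⟩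

/-- KZ packaging of the hat-box substitution: given injectivity, the image and the differentiability + pull-back
identity of `Λ` on the open rectangle `R`, the pinned crux representation `[R, g]` is ONE instance of
Kontsevich–Zagier's rule (2) away from the flat representation `[(0,∞)×(0,1), 4/(1+u²)]`, which EXISTS (the
half-strip and `4/(1+u²)` are `ℚ`-semialgebraic; integrability transported along `Λ`); `Λ` is a `ℚ`-semialgebraic
map (two square roots of rational functions with rational coefficients). [cite: KontsevichZagier2001, §1.2 rule (2)] -/
theorem stub_hatBoxTransfer :
    ∀ (e₁ e₂ e₃ : ℚ), e₁ < e₂ → e₂ < e₃ → 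
      Set.InjOn (fun x : Fin 2 → ℝ => (![Real.sqrt (((e₃ : ℝ) - (e₁ : ℝ)) * ((e₂ : ℝ) - x 0) * (x 1 - (e₂ : ℝ)) / (((e₃ : ℝ) - (e₂ : ℝ)) * (x 0 - (e₁ : ℝ)) * (x 1 - (e₁ : ℝ)))), Real.sqrt (((e₃ : ℝ) - x 0) * ((e₃ : ℝ) - x 1) / (((e₃ : ℝ) - (e₁ : ℝ)) * ((e₃ : ℝ) - (e₂ : ℝ))))] : Fin 2 → ℝ))
        {x : Fin 2 → ℝ | (e₁ : ℝ) < x 0 ∧ x 0 < (e₂ : ℝ) ∧ (e₂ : ℝ) < x 1 ∧ x 1 < (e₃ : ℝ)} →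
      (fun x : Fin 2 → ℝ => (![Real.sqrt (((e₃ : ℝ) - (e₁ : ℝ)) * ((e₂ : ℝ) - x 0) * (x 1 - (e₂ : ℝ)) / (((e₃ : ℝ) - (e₂ : ℝ)) * (x 0 - (e₁ : ℝ)) * (x 1 - (e₁ : ℝ)))), Real.sqrt (((e₃ : ℝ) - x 0) * ((e₃ : ℝ) - x 1) / (((e₃ : ℝ) - (e₁ : ℝ)) * ((e₃ : ℝ) - (e₂ : ℝ))))] : Fin 2 → ℝ)) ''
          {x : Fin 2 → ℝ | (e₁ : ℝ) < x 0 ∧ x 0 < (e₂ : ℝ) ∧ (e₂ : ℝ) < x 1 ∧ x 1 < (e₃ : ℝ)} =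
        {w : Fin 2 → ℝ | 0 < w 0 ∧ 0 < w 1 ∧ w 1 < 1} →
      (∀ x ∈ {x : Fin 2 → ℝ | (e₁ : ℝ) < x 0 ∧ x 0 < (e₂ : ℝ) ∧ (e₂ : ℝ) < x 1 ∧ x 1 < (e₃ : ℝ)}, ∃ L : (Fin 2 → ℝ) →L[ℝ] (Fin 2 → ℝ),
        HasFDerivAt (fun x : Fin 2 → ℝ => (![Real.sqrt (((e₃ : ℝ) - (e₁ : ℝ)) * ((e₂ : ℝ) - x 0) * (x 1 - (e₂ : ℝ)) / (((e₃ : ℝ) - (e₂ : ℝ)) * (x 0 - (e₁ : ℝ)) * (x 1 - (e₁ : ℝ)))), Real.sqrt (((e₃ : ℝ) - x 0) * ((e₃ : ℝ) - x 1) / (((e₃ : ℝ) - (e₁ : ℝ)) * ((e₃ : ℝ) - (e₂ : ℝ))))] : Fin 2 → ℝ)) L x ∧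
          (x 1 - x 0) / Real.sqrt (|(x 0 - (e₁ : ℝ)) * (x 0 - (e₂ : ℝ)) * (x 0 - (e₃ : ℝ))| * |(x 1 - (e₁ : ℝ)) * (x 1 - (e₂ : ℝ)) * (x 1 - (e₃ : ℝ))|) =
            4 / (1 + (Real.sqrt (((e₃ : ℝ) - (e₁ : ℝ)) * ((e₂ : ℝ) - x 0) * (x 1 - (e₂ : ℝ)) / (((e₃ : ℝ) - (e₂ : ℝ)) * (x 0 - (e₁ : ℝ)) * (x 1 - (e₁ : ℝ))))) ^ 2) * |L.det|) →
      ∀ (r : KZ.IntegralRep 2), r.domain = {x : Fin 2 → ℝ | (e₁ : ℝ) < x 0 ∧ x 0 < (e₂ : ℝ) ∧ (e₂ : ℝ) < x 1 ∧ x 1 < (e₃ : ℝ)} →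
        Set.EqOn r.integrand (fun x : Fin 2 → ℝ => (x 1 - x 0) / Real.sqrt (|(x 0 - (e₁ : ℝ)) * (x 0 - (e₂ : ℝ)) * (x 0 - (e₃ : ℝ))| * |(x 1 - (e₁ : ℝ)) * (x 1 - (e₂ : ℝ)) * (x 1 - (e₃ : ℝ))|)) r.domain →
        ∃ p : KZ.IntegralRep 2, p.domain = {w : Fin 2 → ℝ | 0 < w 0 ∧ 0 < w 1 ∧ w 1 < 1} ∧
          p.integrand = (fun w : Fin 2 → ℝ => 4 / (1 + w 0 ^ 2)) ∧ KZ.of r - KZ.of p ∈ KZ.changeOfVariablesRel := by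
  intro e₁ e₂ e₃ h12 h23 hinj himg hJ r hrd hri
  have h12' : (e₁ : ℝ) < e₂ := Rat.cast_lt.2 h12
  have h23' : (e₂ : ℝ) < e₃ := Rat.cast_lt.2 h23
  -- the rectangle `R` is `ℚ`-semialgebraic (it is the domain of `r`)
  have hR := r.isSemialgebraic_domain
  rw [hrd] at hR
  -- the half-strip `H` is `ℚ`-semialgebraic
  have hH : IsSemialgebraic ℚ {w : Fin 2 → ℝ | 0 < w 0 ∧ 0 < w 1 ∧ w 1 < 1} := by
    have h0 := isSemialgebraic_setOf_eval_pos (k := ℚ) (R := ℝ) (X 0 : MvPolynomial (Fin 2) ℚ)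
    have h1 := isSemialgebraic_setOf_eval_pos (k := ℚ) (R := ℝ) (X 1 : MvPolynomial (Fin 2) ℚ)
    have h2 := isSemialgebraic_setOf_eval_pos (k := ℚ) (R := ℝ) (1 - X 1 : MvPolynomial (Fin 2) ℚ)
    simp only [MvPolynomial.aeval_X, map_sub, map_one, sub_pos] at h0 h1 h2
    convert h0.inter (h1.inter h2) using 1
    ext w
    simp only [mem_setOf_eq, mem_inter_iff]
  -- the flat integrand `4/(1+u²)` is `ℚ`-semialgebraic on `H`
  have hf : IsSemialgebraicFunOn ℚ {w : Fin 2 → ℝ | 0 < w 0 ∧ 0 < w 1 ∧ w 1 < 1}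
      (fun w : Fin 2 → ℝ => 4 / (1 + w 0 ^ 2)) := by
    refine (isSemialgebraicFunOn_aeval_div_aeval hH (C 4 : MvPolynomial (Fin 2) ℚ) (1 + X 0 ^ 2)
      (fun w _ => ?_)).congr (fun w _ => ?_)
    · simp only [map_add, map_one, map_pow, MvPolynomial.aeval_X]
      positivity
    · simp only [map_add, map_one, map_pow, MvPolynomial.aeval_X, MvPolynomial.aeval_C, eq_ratCast,
        Rat.cast_ofNat]
  refine hatBox_changeOfVariables_of r hrd hri hinj himg hH hf
    (IsSemialgebraicMapOn.of_forall hR (Fin.forall_fin_two.2 ⟨?_, ?_⟩)) (fun x hx => ?_)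
  · -- first coordinate `u = √((e₃−e₁)(e₂−λ)(μ−e₂)/((e₃−e₂)(λ−e₁)(μ−e₁)))`
    simp only [Matrix.cons_val_zero]
    refine IsSemialgebraicFunOn.sqrt_holds ?_
    refine (isSemialgebraicFunOn_aeval_div_aeval hR
      ((C e₃ - C e₁) * (C e₂ - X 0) * (X 1 - C e₂) : MvPolynomial (Fin 2) ℚ)
      ((C e₃ - C e₂) * (X 0 - C e₁) * (X 1 - C e₁)) (fun x hx => ?_)).congr (fun x _ => ?_)
    · obtain ⟨h1, h2, h3, -⟩ := hx
      simp only [map_mul, map_sub, MvPolynomial.aeval_C, MvPolynomial.aeval_X, eq_ratCast]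
      exact mul_ne_zero (mul_ne_zero (sub_pos.2 h23').ne' (sub_pos.2 h1).ne')
        (sub_pos.2 (h1.trans (h2.trans h3))).ne'
    · simp only [map_mul, map_sub, MvPolynomial.aeval_C, MvPolynomial.aeval_X, eq_ratCast]
  · -- second coordinate `z = √((e₃−λ)(e₃−μ)/((e₃−e₁)(e₃−e₂)))`
    simp only [Matrix.cons_val_one, Matrix.cons_val_zero]
    refine IsSemialgebraicFunOn.sqrt_holds ?_
    refine (isSemialgebraicFunOn_aeval_div_aeval hR
      ((C e₃ - X 0) * (C e₃ - X 1) : MvPolynomial (Fin 2) ℚ)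
      ((C e₃ - C e₁) * (C e₃ - C e₂)) (fun x _ => ?_)).congr (fun x _ => ?_)
    · simp only [map_mul, map_sub, MvPolynomial.aeval_C, eq_ratCast]
      exact mul_ne_zero (sub_pos.2 (h12'.trans h23')).ne' (sub_pos.2 h23').ne'
    · simp only [map_mul, map_sub, MvPolynomial.aeval_C, MvPolynomial.aeval_X, eq_ratCast]
  · -- differentiability and the pull-back identity (hypothesis)
    obtain ⟨L, hL, hg⟩ := hJ x hx
    refine ⟨L, hL, ?_⟩
    simpa only [Matrix.cons_val_zero] using hg

end Summit.KontsevichZagierPeriods.UnfoldedStokes.LegendreCubicFormLine
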